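import Mathlib.GroupTheory.Perm.Fin
import Mathlib.GroupTheory.Perm.Sign
import Mathlib.GroupTheory.SpecificGroups.Alternating
import HarnessLib

/-!
# The `S₄`-dictionary for 4-cycles as a ONE-SIDED inequality of permutation characters

Topic `Summits/QuantumAdvantage/QuantumAdvantage/Theorems`, cell B2b-1 (linnik-cubic), PART A (gen 8);
helper toward the crux `DegreeOnePrimesEscape` (stmt-QuantumAdvantage-11543) of route
`LinnikCubicClassGroups`.  HONEST FRAMING: the value of this file is a THEOREM (kernel-checked finite
group theory) — NOT summit progress.

For a subgroup `H ≤ G` and `x ∈ G` write `c_H(x) = #{g ∈ G : g x g⁻¹ ∈ H} = |H| · #Fix(x | G/H)`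
(`|H|` times the value at `x` of the permutation character `Ind_H^G 1`).  In `G = S₄` (realised as
`Equiv.Perm (Fin 4)`), with `A = A₄` (order `12`), `D` a dihedral Sylow `2`-subgroup (order `8`, the
symmetries of the square `0–1–2–3`) and `S = Stab(0) ≅ S₃` (order `6`), the class function

  `f = 7 − 2·Ind_A 1 − Ind_D 1 − 3·Ind_S 1`

takes the values `f(1) = −12`, `f = 0` on transpositions, double transpositions and 3-cycles, and
`f = 6` on 4-cycles; and the 4-cycles are exactly the `y` such that neither `y` nor `y²` has a fixed
point.  Hence (`exists_quarticD8_key`, proved by `decide`; multiplied through by `24`)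

  `168 ≤ 4·c_A(y) + 3·c_D(y) + 12·c_S(y) + 144·𝟙[c_S(y) = 0 ∧ c_S(y²) = 0]`   for every `y ∈ S₄`.

The point: `6·𝟙[4-cycle] ≥ f` with NONPOSITIVE coefficients on the three non-trivial permutation
characters, while the mean of `f` is `7 − 2 − 1 − 3 = 1 > 0`.  Read through the Frobenius dictionary
(`c_{Gal(N/E)}(Frob_p) = |Gal(N/E)| · #{𝔭 ∣ p in E : f(𝔭|p) = 1}`), it bounds the number of primes
`p ≤ x` that are inert in an `S₄`-quartic field from BELOW using only the prime number theorem for `ℚ`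
and UPPER bounds for the prime ideal counting functions of the quadratic, cubic-resolvent and quartic
subfields of its Galois closure (`…QuarticS4InertPrime.lean`).  `exists_quartic_subgroups` transports
the inequality to any group `G` along an isomorphism `ψ : G ≃* S₄` (no definitions: the subgroups are
produced existentially with their orders `12, 8` and the order `6` of the given point stabiliser).
-/

namespace Summit.QuantumAdvantage.QuantumAdvantage.Theorems.DegreeOnePrimesEscape

open Equiv Equiv.Perm

/-! ### The computation in `S₄ = Perm (Fin 4)` -/

set_option maxRecDepth 8000 in
/-- **The one-sided `S₄`-dictionary for 4-cycles** (a `decide` computation).  There is an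
`8`-element subset `D ⊆ S₄` containing `1` and closed under products and inverses (the dihedral group of
the square `0–1–2–3`) such that for every `y ∈ S₄`, with `c_A(y) = #{q : q y q⁻¹ even}`,
`c_D(y) = #{q : q y q⁻¹ ∈ D}`, `c_S(y) = #{q : (q y q⁻¹)(0) = 0}`:
`168 ≤ 4 c_A(y) + 3 c_D(y) + 12 c_S(y) + 144·𝟙[c_S(y) = 0 ∧ c_S(y²) = 0]`. -/
theorem exists_quarticD8_key :
    ∃ D : Finset (Perm (Fin 4)), D.card = 8 ∧ (1 : Perm (Fin 4)) ∈ D ∧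
      (∀ a ∈ D, ∀ b ∈ D, a * b ∈ D) ∧ (∀ a ∈ D, a⁻¹ ∈ D) ∧
      ∀ y : Perm (Fin 4),
        168 ≤ 4 * (Finset.univ.filter fun q : Perm (Fin 4) => Perm.sign (q * y * q⁻¹) = 1).card +
          3 * (Finset.univ.filter fun q : Perm (Fin 4) => q * y * q⁻¹ ∈ D).card +
          12 * (Finset.univ.filter fun q : Perm (Fin 4) => (q * y * q⁻¹) 0 = 0).card +
          (if (Finset.univ.filter fun q : Perm (Fin 4) => (q * y * q⁻¹) 0 = 0).card = 0 ∧
              (Finset.univ.filter fun q : Perm (Fin 4) => (q * (y * y) * q⁻¹) 0 = 0).card = 0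
            then 144 else 0) := by
  refine ⟨{1, finRotate 4, finRotate 4 ^ 2, finRotate 4 ^ 3, Equiv.swap 0 2,
    finRotate 4 * Equiv.swap 0 2, finRotate 4 ^ 2 * Equiv.swap 0 2, finRotate 4 ^ 3 * Equiv.swap 0 2},
    by decide, by decide, by decide, by decide, by decide⟩

/-- `#{q ∈ S₄ : q 0 = 0} = 6`. -/
theorem card_filter_apply_zero_eq :
    (Finset.univ.filter fun q : Perm (Fin 4) => q 0 = 0).card = 6 := by decide

/-- `#{q ∈ S₄ : q even} = 12`. -/
theorem card_filter_sign_eq_one :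
    (Finset.univ.filter fun q : Perm (Fin 4) => Perm.sign q = 1).card = 12 := by decide

/-- `#S₄ = 24`. -/
theorem card_perm_fin_four : Fintype.card (Perm (Fin 4)) = 24 := by
  rw [Fintype.card_perm, Fintype.card_fin]; rfl

/-! ### Transport along an isomorphism `ψ : G ≃* S₄` -/

section Transport

variable {G : Type*} [Group G] (ψ : G ≃* Perm (Fin 4))

/-- Transport of a conjugation count: if `H = ψ⁻¹{q : P q}` then
`#{g ∈ G : g x g⁻¹ ∈ H} = #{q ∈ S₄ : P (q ψ(x) q⁻¹)}`. -/
theorem natCard_conj_mem_eq_card_filter (H : Subgroup G) (P : Perm (Fin 4) → Prop)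
    [DecidablePred P] (hH : ∀ g, g ∈ H ↔ P (ψ g)) (x : G) :
    Nat.card {g : G // g * x * g⁻¹ ∈ H} =
      (Finset.univ.filter fun q : Perm (Fin 4) => P (q * ψ x * q⁻¹)).card := by
  have e : {g : G // g * x * g⁻¹ ∈ H} ≃ {q : Perm (Fin 4) // P (q * ψ x * q⁻¹)} :=
    { toFun := fun g => ⟨ψ g.1, by
        have h := (hH _).mp g.2
        rwa [map_mul, map_mul, map_inv] at h⟩
      invFun := fun q => ⟨ψ.symm q.1, by
        rw [hH, map_mul, map_mul, map_inv, MulEquiv.apply_symm_apply]; exact q.2⟩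
      left_inv := fun g => Subtype.ext (ψ.symm_apply_apply g.1)
      right_inv := fun q => Subtype.ext (ψ.apply_symm_apply q.1) }
  rw [Nat.card_congr e, Nat.card_eq_fintype_card, Fintype.card_subtype]

/-- Transport of the order of a subgroup: if `H = ψ⁻¹{q : P q}` then `|H| = #{q ∈ S₄ : P q}`. -/
theorem natCard_subgroup_eq_card_filter (H : Subgroup G) (P : Perm (Fin 4) → Prop)
    [DecidablePred P] (hH : ∀ g, g ∈ H ↔ P (ψ g)) :
    Nat.card H = (Finset.univ.filter fun q : Perm (Fin 4) => P q).card := by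
  have e : H ≃ {q : Perm (Fin 4) // P q} :=
    { toFun := fun g => ⟨ψ g.1, (hH _).mp g.2⟩
      invFun := fun q => ⟨ψ.symm q.1, by rw [hH, MulEquiv.apply_symm_apply]; exact q.2⟩
      left_inv := fun g => Subtype.ext (ψ.symm_apply_apply g.1)
      right_inv := fun q => Subtype.ext (ψ.apply_symm_apply q.1) }
  rw [Nat.card_congr e, Nat.card_eq_fintype_card, Fintype.card_subtype]

include ψ in
/-- `|G| = 24`. -/
theorem natCard_eq_of_mulEquiv_perm_fin_four : Nat.card G = 24 := by
  rw [Nat.card_congr ψ.toEquiv, Nat.card_eq_fintype_card, card_perm_fin_four]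

/-- A point stabiliser `S = ψ⁻¹ Stab(0)` has order `6`. -/
theorem natCard_eq_six_of_stabilizer (S : Subgroup G) (hS : ∀ g, g ∈ S ↔ ψ g 0 = 0) :
    Nat.card S = 6 := by
  rw [natCard_subgroup_eq_card_filter ψ S (fun q => q 0 = 0) hS, card_filter_apply_zero_eq]

/-- **The one-sided dictionary, transported to `G ≅ S₄`.** Given `ψ : G ≃* S₄` and the point
stabiliser `S = ψ⁻¹ Stab(0)`, there are subgroups `A` (`= ψ⁻¹ A₄`, order `12`) and `D` (`= ψ⁻¹ D₈`,
order `8`) of `G` such that `|S| = 6` and, for every `x ∈ G`,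
`168 ≤ 4 c_A(x) + 3 c_D(x) + 12 c_S(x) + 144·𝟙[c_S(x) = 0 ∧ c_S(x²) = 0]`. -/
theorem exists_quartic_subgroups (S : Subgroup G) (hS : ∀ g, g ∈ S ↔ ψ g 0 = 0) :
    ∃ A D : Subgroup G, Nat.card A = 12 ∧ Nat.card D = 8 ∧ Nat.card S = 6 ∧
      ∀ x : G, 168 ≤ 4 * Nat.card {g : G // g * x * g⁻¹ ∈ A} +
        3 * Nat.card {g : G // g * x * g⁻¹ ∈ D} + 12 * Nat.card {g : G // g * x * g⁻¹ ∈ S} +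
        (if Nat.card {g : G // g * x * g⁻¹ ∈ S} = 0 ∧ Nat.card {g : G // g * (x * x) * g⁻¹ ∈ S} = 0
          then 144 else 0) := by
  classical
  obtain ⟨D₈, hcard, hone, hmul, hinv, hkey⟩ := exists_quarticD8_key
  -- the dihedral subgroup of `S₄` and its pull-back
  let D₀ : Subgroup (Perm (Fin 4)) :=
    { carrier := {σ | σ ∈ D₈}
      mul_mem' := fun {a} {b} ha hb => hmul a ha b hb
      one_mem' := hone
      inv_mem' := fun {a} ha => hinv a ha }
  let A : Subgroup G := (alternatingGroup (Fin 4)).comap ψ.toMonoidHom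
  let D : Subgroup G := D₀.comap ψ.toMonoidHom
  have hA : ∀ g, g ∈ A ↔ Perm.sign (ψ g) = 1 := fun g => by
    rw [Subgroup.mem_comap, Equiv.Perm.mem_alternatingGroup]; rfl
  have hD : ∀ g, g ∈ D ↔ ψ g ∈ D₈ := fun g => by
    rw [Subgroup.mem_comap]; rfl
  refine ⟨A, D, ?_, ?_, natCard_eq_six_of_stabilizer ψ S hS, fun x => ?_⟩
  · rw [natCard_subgroup_eq_card_filter ψ A (fun q => Perm.sign q = 1) hA, card_filter_sign_eq_one]
  · rw [natCard_subgroup_eq_card_filter ψ D (fun q => q ∈ D₈) hD, Finset.filter_mem_eq_inter,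
      Finset.univ_inter, hcard]
  · rw [natCard_conj_mem_eq_card_filter ψ A (fun q => Perm.sign q = 1) hA,
      natCard_conj_mem_eq_card_filter ψ D (fun q => q ∈ D₈) hD,
      natCard_conj_mem_eq_card_filter ψ S (fun q => q 0 = 0) hS,
      natCard_conj_mem_eq_card_filter ψ S (fun q => q 0 = 0) hS, map_mul]
    exact hkey (ψ x)

end Transport

end Summit.QuantumAdvantage.QuantumAdvantage.Theorems.DegreeOnePrimesEscape
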